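import Literature.AnabelianGeometry.SemiGraphs.PSCUnrLevelBridge
import HarnessLib

/-!
# [CombGC] Thm. 1.6 (ii), descent step (route 2), the level-`U` PACKAGE: from "`β_U` group-theoretically
# verticial" to the `α`-graphic-mod-`Ker″` vertex bijection of `PSCVertexBijectionEquivariance`

Mochizuki, *A combinatorial version of the Grothendieck conjecture*, Tohoku Math. J. **59** (2007) [CombGC],
proof of Theorem 1.6 (ii), author's ms p. 14 l.22–31 ("to prove that `α` is group-theoretically verticial,
it suffices to prove [cf. the proof of assertion (i)] that `α` induces a functorial bijection between the
sets of vertices of `G`, `H` … it suffices to prove that `β` is group-theoretically verticial"), render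
`paper:url-6994f81053dc` p0014; Prop. 1.2 (i), unramified case, p. 8. [cite: MochizukiCombGC2007, Thm 1.6(ii) p.14]

PROOF-ONLY file (abc-iut cell, layer L3, `plan/L3/SUBDAG-CombGC-Thm16.md` row T16-L09b, writer's ruling
v6 "ROUTE 2 … WANT 2", holder abc-iut-w5-d188; sequel to `PSCUnrLevelBridge.lean`).  **`graphic_mod_package_unr`**:
at a level `U` (open normal of finite index, `U' = α U`), from a GROUP-THEORETICALLY VERTICIAL
`β_U : Π^unr_{G_U} ≅ Π^unr_{H_{U'}}` over `α|_U` (for the coverings `G.restrictBD U hU bd`,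
`H.restrictBD U' hU' bd'` of abc-iut-L3-t4) and Prop. 1.2 (i), unramified case
(`UnrVerticialOpenInterDeterminesVertex`) for both STURDY coverings BY NAME, the level-`U` datum
`∃ K″ (normal in Π_H) (e : Vert(G_U) ≃ Vert(H_{U'})), (α-graphic modulo K″) ∧ (separated modulo K″)` consumed
by `PSCVertexBijectionEquivariance.isGroupTheoreticallyVerticial_of_graphic_mod` (p421678), with
`K″ = Ker(Π_{H_{U'}} ↠ Π^unr)↑` and the bijection `e` DERIVED (by choice + `Equiv.ofBijective`) from the class
correspondence (`matched_vertex_of_isUnrGroupTheoreticallyVerticial` / `…'`) and the separation on both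
sides.  Supplying it at every open normal `U` proves `α` group-theoretically verticial — "it suffices to
prove that `β` is group-theoretically verticial", level by level, in kernel form.  Pure plumbing; no
definitions; nothing here takes a side on [IUTchIII] Cor. 3.12.
-/

noncomputable section

namespace Literature.AnabelianGeometry.SemiGraphs

namespace PSCDatum

open scoped Pointwise
open PSCCovering

universe u

variable {P : Type u} [Group P] [TopologicalSpace P]
variable {P' : Type u} [Group P'] [TopologicalSpace P']
variable [IsTopologicalGroup P] [IsTopologicalGroup P']
variable (G : PSCDatum P) (H : PSCDatum P') (α : P ≃ₜ* P')
variable (U : Subgroup P) [U.FiniteIndex] [U.Normal] (hU : IsOpen (U : Set P)) (bd : G.BranchData)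
variable (U' : Subgroup P') [U'.FiniteIndex] [U'.Normal] (hU' : IsOpen (U' : Set P')) (bd' : H.BranchData)
variable (hUU' : U.map α.toMulEquiv.toMonoidHom = U')
variable (αU : U ≃ₜ* U') (hαU : ∀ u : U, ((αU u : U') : P') = α u)
variable (β : (U ⧸ (G.restrictBD U hU bd).unrKer) ≃ₜ* (U' ⧸ (H.restrictBD U' hU' bd').unrKer))
variable (hβ : ∀ u : U, β (QuotientGroup.mk' (G.restrictBD U hU bd).unrKer u) =
  QuotientGroup.mk' (H.restrictBD U' hU' bd').unrKer (αU u))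

include hUU' hαU hβ in
/-- **Route 2, PACKAGED: one level of the descent from `β_U` group-theoretically verticial.**  From a
group-theoretically verticial `β_U : Π^unr_{G_U} ≅ Π^unr_{H_{U'}}` over `α|_U` and Prop. 1.2 (i), unramified
case, for the (sturdy) coverings `G_U`, `H_{U'}` (BY NAME), the level-`U` datum of p421678's
`isGroupTheoreticallyVerticial_of_graphic_mod`: `K″ = Ker(Π_{H_{U'}} ↠ Π^unr)↑` (normal in `Π_H`), a bijection
of the vertex sets as double cosets (DERIVED from the class correspondence), `α`-graphic modulo `K″`,
separated modulo `K″`.  Supplying it at every open normal `U` proves `α` group-theoretically verticial.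
[cite: MochizukiCombGC2007, Thm 1.6(ii) p.14] -/
theorem graphic_mod_package_unr
    (hgt : (G.restrictBD U hU bd).IsUnrGroupTheoreticallyVerticial (H.restrictBD U' hU' bd') β)
    (hVG : (G.restrictBD U hU bd).UnrVerticialOpenInterDeterminesVertex)
    (hsG : (G.restrictBD U hU bd).IsSturdy)
    (hVH : (H.restrictBD U' hU' bd').UnrVerticialOpenInterDeterminesVertex)
    (hsH : (H.restrictBD U' hU' bd').IsSturdy) :
    ∃ (K' : Subgroup P') (_ : K'.Normal)
      (e : (Σ v, DoubleCoset.Quotient (U : Set P) (G.vertGp v : Set P)) ≃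
        (Σ w, DoubleCoset.Quotient (U' : Set P') (H.vertGp w : Set P'))),
      (∀ (v : G.graph.V) (x : P) (w : H.graph.V) (y : P'),
        e ⟨v, DoubleCoset.mk U (G.vertGp v) x⟩ = ⟨w, DoubleCoset.mk U' (H.vertGp w) y⟩ →
          ∃ u' ∈ U', (U ⊓ ConjAct.toConjAct x • G.vertGp v).map α.toMulEquiv.toMonoidHom ⊔ K' =
            ConjAct.toConjAct u' • ((U' ⊓ ConjAct.toConjAct y • H.vertGp w) ⊔ K')) ∧
      (∀ (w₁ : H.graph.V) (y₁ : P') (w₂ : H.graph.V) (y₂ : P'),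
        (∃ u' ∈ U', (U' ⊓ ConjAct.toConjAct y₁ • H.vertGp w₁) ⊔ K' =
            ConjAct.toConjAct u' • ((U' ⊓ ConjAct.toConjAct y₂ • H.vertGp w₂) ⊔ K')) →
          (⟨w₁, DoubleCoset.mk U' (H.vertGp w₁) y₁⟩ :
              Σ w, DoubleCoset.Quotient (U' : Set P') (H.vertGp w : Set P')) =
            ⟨w₂, DoubleCoset.mk U' (H.vertGp w₂) y₂⟩) := by
  have hKn : ((H.restrictBD U' hU' bd').unrKer.map U'.subtype).Normal :=
    H.map_subtype_unrKer_restrict_normal U' hU'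
  have hKGn : ((G.restrictBD U hU bd).unrKer.map U.subtype).Normal :=
    G.map_subtype_unrKer_restrict_normal U hU
  -- the relation "graphic modulo K″" between a level-`U` vertex group of `G` and one of `H`
  let R : G.graph.V → P → H.graph.V → P' → Prop := fun v x w y =>
    ∃ u' ∈ U', (U ⊓ ConjAct.toConjAct x • G.vertGp v).map α.toMulEquiv.toMonoidHom ⊔
        (H.restrictBD U' hU' bd').unrKer.map U'.subtype =
      ConjAct.toConjAct u' • ((U' ⊓ ConjAct.toConjAct y • H.vertGp w) ⊔
        (H.restrictBD U' hU' bd').unrKer.map U'.subtype)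
  -- separation on the two sides
  have sepH : ∀ {w₁ y₁ w₂ y₂}, (∃ u' ∈ U', (U' ⊓ ConjAct.toConjAct y₁ • H.vertGp w₁) ⊔
        (H.restrictBD U' hU' bd').unrKer.map U'.subtype = ConjAct.toConjAct u' •
        ((U' ⊓ ConjAct.toConjAct y₂ • H.vertGp w₂) ⊔ (H.restrictBD U' hU' bd').unrKer.map U'.subtype)) →
      (⟨w₁, DoubleCoset.mk U' (H.vertGp w₁) y₁⟩ :
          Σ w, DoubleCoset.Quotient (U' : Set P') (H.vertGp w : Set P')) =
        ⟨w₂, DoubleCoset.mk U' (H.vertGp w₂) y₂⟩ :=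
    fun h => sep_mod_unrKer_of_unrVerticialOpenInter H U' hU' bd' hVH hsH h
  have sepG : ∀ {v₁ x₁ v₂ x₂}, (∃ u ∈ U, (U ⊓ ConjAct.toConjAct x₁ • G.vertGp v₁) ⊔
        (G.restrictBD U hU bd).unrKer.map U.subtype = ConjAct.toConjAct u •
        ((U ⊓ ConjAct.toConjAct x₂ • G.vertGp v₂) ⊔ (G.restrictBD U hU bd).unrKer.map U.subtype)) →
      (⟨v₁, DoubleCoset.mk U (G.vertGp v₁) x₁⟩ :
          Σ v, DoubleCoset.Quotient (U : Set P) (G.vertGp v : Set P)) =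
        ⟨v₂, DoubleCoset.mk U (G.vertGp v₂) x₂⟩ :=
    fun h => sep_mod_unrKer_of_unrVerticialOpenInter G U hU bd hVG hsG h
  -- (R1) changing representatives
  have R1 : ∀ {v x x' w y y'}, R v x w y → DoubleCoset.mk U (G.vertGp v) x = DoubleCoset.mk U (G.vertGp v) x' →
      DoubleCoset.mk U' (H.vertGp w) y = DoubleCoset.mk U' (H.vertGp w) y' → R v x' w y' := by
    rintro v x x' w y y' ⟨u', hu', h⟩ hx hy
    obtain ⟨u₁, hu₁, h₁⟩ := exists_conj_of_mk_eq (inferInstance : U.Normal) (G.vertGp v) hx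
    obtain ⟨u₂, hu₂, h₂⟩ := exists_conj_of_mk_eq (inferInstance : U'.Normal) (H.vertGp w) hy
    have hαu₁ : α u₁ ∈ U' := by rw [← hUU']; exact ⟨u₁, hu₁, rfl⟩
    refine ⟨α u₁ * u' * u₂⁻¹, U'.mul_mem (U'.mul_mem hαu₁ hu') (U'.inv_mem hu₂), ?_⟩
    rw [h₁, map_conj_smul, ← conjAct_smul_sup_of_normal hKn]
    change ConjAct.toConjAct (α u₁) • _ = _
    rw [h, h₂, ← conjAct_smul_sup_of_normal hKn, ← mul_smul, ← mul_smul, ← map_mul, ← map_mul]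
    congr 2
    group
  -- (R2) two `G`-vertices related to the same `H`-vertex coincide
  have R2 : ∀ {v₁ x₁ v₂ x₂ w y}, R v₁ x₁ w y → R v₂ x₂ w y →
      (⟨v₁, DoubleCoset.mk U (G.vertGp v₁) x₁⟩ :
          Σ v, DoubleCoset.Quotient (U : Set P) (G.vertGp v : Set P)) =
        ⟨v₂, DoubleCoset.mk U (G.vertGp v₂) x₂⟩ := by
    rintro v₁ x₁ v₂ x₂ w y ⟨u₁, hu₁, h₁⟩ ⟨u₂, hu₂, h₂⟩
    refine sepG (conj_mod_unrKer_of_map G H α U hU bd U' hU' bd' hUU' αU hαU β hβ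
      (U'.mul_mem hu₁ (U'.inv_mem hu₂)) ?_)
    rw [h₁, map_mul, mul_smul, map_inv, eq_inv_smul_iff.mpr h₂.symm]
  -- (R3) two `H`-vertices related to the same `G`-vertex coincide
  have R3 : ∀ {v x w₁ y₁ w₂ y₂}, R v x w₁ y₁ → R v x w₂ y₂ →
      (⟨w₁, DoubleCoset.mk U' (H.vertGp w₁) y₁⟩ :
          Σ w, DoubleCoset.Quotient (U' : Set P') (H.vertGp w : Set P')) =
        ⟨w₂, DoubleCoset.mk U' (H.vertGp w₂) y₂⟩ := by
    rintro v x w₁ y₁ w₂ y₂ ⟨u₁, hu₁, h₁⟩ ⟨u₂, hu₂, h₂⟩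
    refine sepH ⟨u₁⁻¹ * u₂, U'.mul_mem (U'.inv_mem hu₁) hu₂, ?_⟩
    rw [map_mul, mul_smul, ← h₂, map_inv, eq_inv_smul_iff, ← h₁]
  -- the matching function, by choice, and its properties
  have hm : ∀ q : Σ v, DoubleCoset.Quotient (U : Set P) (G.vertGp v : Set P),
      ∃ wy : Σ w, DoubleCoset.Quotient (U' : Set P') (H.vertGp w : Set P'), ∃ y : P',
        wy.2 = DoubleCoset.mk U' (H.vertGp wy.1) y ∧ R q.1 q.2.out wy.1 y := by
    intro q
    obtain ⟨w, y, hR⟩ := matched_vertex_of_isUnrGroupTheoreticallyVerticial G H α U hU bd U' hU' bd' hUU'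
      αU hαU β hβ hgt q.1 q.2.out
    exact ⟨⟨w, DoubleCoset.mk U' (H.vertGp w) y⟩, y, rfl, hR⟩
  choose f yf hyf hRf using hm
  have hfR : ∀ v x, R v x (f ⟨v, DoubleCoset.mk U (G.vertGp v) x⟩).1 (yf ⟨v, DoubleCoset.mk U (G.vertGp v) x⟩) :=
    fun v x => R1 (hRf ⟨v, DoubleCoset.mk U (G.vertGp v) x⟩) (DoubleCoset.out_eq' _ _ _) rfl
  have hf_eq : ∀ v x, f ⟨v, DoubleCoset.mk U (G.vertGp v) x⟩ =
      ⟨(f ⟨v, DoubleCoset.mk U (G.vertGp v) x⟩).1,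
        DoubleCoset.mk U' (H.vertGp _) (yf ⟨v, DoubleCoset.mk U (G.vertGp v) x⟩)⟩ := by
    intro v x
    have := hyf ⟨v, DoubleCoset.mk U (G.vertGp v) x⟩
    rcases hq : f ⟨v, DoubleCoset.mk U (G.vertGp v) x⟩ with ⟨w, q⟩
    rw [hq] at this
    dsimp only at this ⊢
    rw [this]
  have hinj : Function.Injective f := by
    rintro ⟨v₁, q₁⟩ ⟨v₂, q₂⟩ hq
    obtain ⟨x₁, rfl⟩ : ∃ x₁, DoubleCoset.mk U (G.vertGp v₁) x₁ = q₁ := ⟨q₁.out, DoubleCoset.out_eq' _ _ _⟩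
    obtain ⟨x₂, rfl⟩ : ∃ x₂, DoubleCoset.mk U (G.vertGp v₂) x₂ = q₂ := ⟨q₂.out, DoubleCoset.out_eq' _ _ _⟩
    have h₁ := hfR v₁ x₁
    have h₂ := hfR v₂ x₂
    rw [hf_eq] at hq
    conv_rhs at hq => rw [hf_eq]
    obtain ⟨hw, hyy⟩ := Sigma.mk.inj_iff.mp hq
    revert h₂
    generalize (f ⟨v₂, DoubleCoset.mk U (G.vertGp v₂) x₂⟩).1 = w₂ at hw hyy
    intro h₂
    subst hw
    have hyy' := eq_of_heq hyy
    exact R2 h₁ (R1 h₂ rfl hyy'.symm)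
  have hsurj : Function.Surjective f := by
    rintro ⟨w, q⟩
    obtain ⟨y, rfl⟩ : ∃ y, DoubleCoset.mk U' (H.vertGp w) y = q := ⟨q.out, DoubleCoset.out_eq' _ _ _⟩
    obtain ⟨v, x, hR⟩ := matched_vertex_of_isUnrGroupTheoreticallyVerticial' G H α U hU bd U' hU' bd' hUU'
      αU hαU β hβ hgt w y
    refine ⟨⟨v, DoubleCoset.mk U (G.vertGp v) x⟩, ?_⟩
    rw [hf_eq]
    exact R3 (hfR v x) hR
  refine ⟨(H.restrictBD U' hU' bd').unrKer.map U'.subtype, hKn, Equiv.ofBijective f ⟨hinj, hsurj⟩,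
    ?_, fun w₁ y₁ w₂ y₂ h => sepH h⟩
  intro v x w y hexy
  rw [Equiv.ofBijective_apply, hf_eq] at hexy
  obtain ⟨hw, hyy⟩ := Sigma.mk.inj_iff.mp hexy
  have hR := hfR v x
  revert hR
  generalize (f ⟨v, DoubleCoset.mk U (G.vertGp v) x⟩).1 = w' at hw hyy
  intro hR
  subst hw
  exact R1 hR rfl (eq_of_heq hyy)


end PSCDatum

end Literature.AnabelianGeometry.SemiGraphs
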